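import Summits.ResolutionOfSingularities.ResolutionOfSingularities.Theorems.PurelyInseparableDim4FlatAbsorbPrep
import HarnessLib
import HarnessLib.Audit.Tags

/-!
# Purely inseparable fourfolds — flat absorption, part 2: translations commute with the chart transform of a
# centre they avoid, with cleaning (characteristic `p`, `q = p`), and preserve permissibility

Census cell «res-dim4-pi» (D-0157 DOOR 2); seat res-rescue-typ-3 g8 (rescue base on loan per director-resolution
DR-E8 (4)); def-free support for the ∀K column of the F4-C instrument (desk WORD #65 (c)).  [OURS · counted 0 ·
statements about OUR frame-v4 game (`State`, `Edge`, `StateWins`, `InScopeStateWins`) and plain polynomial algebra,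
not about resolution.]  CONTEXT: the ∀K certificates of record (res-dim4-p-14's `UCert`/`UICert`) stop wherever the
`q`-fold locus of a chart contains a COORDINATE FLAT of positive dimension (B owns replies with transcendental free
coordinates; measured on the RUN 4b band: 679 / 1 105 roots have such a chart in EVERY permissible first centre).
FLAT ABSORPTION (file `…FlatAbsorb`): those replies are harmless as soon as A's next centre avoids the free coordinates of
the flat, because the coordinate-centre step commutes with translations off the centre.
THIS FILE: §3 `translate_add` (`translate (b + v) = translate v ∘ translate b`), `killed_translate` (char `p`:
`(x + c)^p = x^p + c^p`), `deletePthPowers_translate_deletePthPowers` (cleaning twice), `killed_chartTransform`,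
`deletePthPowers_translate_chartTransform_deletePthPowers`, **`chartTransform_translate_of_forall`** (the chart transform
of the centre `S ∋ j` commutes with every translation supported OFF `S`), `isPermissibleCentre_deletePthPowers_translate`.
Nothing here proves resolution of singularities in dimension ≥ 4 / characteristic `p`; F4-C(2,2) stays OPEN.  AI work,
weaker than expert review.  bears_on: LADDER-RESOLUTION:D157-DOOR2 (res-dim4-pi · F4-C ∀K column · flat absorption).
Supports stmt-ResolutionOfSingularities-16155 (helper).
-/

set_option linter.dupNamespace false

noncomputable section
open MvPolynomial Finset
open scoped BigOperators
namespace Summit.ResolutionOfSingularities.ResolutionOfSingularities.Theorems.PIDim4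

namespace FlatAbsorb

open Literature.AlgebraicGeometry.Resolution
open Literature.AlgebraicGeometry.Resolution.Hauser2010
open Literature.AlgebraicGeometry.Resolution.CentreBlowup
open InScopeWinCert

variable {K : Type} [Field K] [DecidableEq K]

/-! ## §3 Translations, the chart transform and the step -/

omit [DecidableEq K] in
/-- Translation is the algebra map `x_i ↦ x_i + b_i`; on a variable. [folklore] -/
theorem translate_X (b : Fin 4 → K) (i : Fin 4) :
    PointBlowup.translate b (X i : MvPolynomial (Fin 4) K) = X i + C (b i) := by
  unfold PointBlowup.translate; rw [aeval_X]

omit [DecidableEq K] in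
/-- Translation of a constant. [folklore] -/
theorem translate_C (b : Fin 4 → K) (c : K) :
    PointBlowup.translate b (C c : MvPolynomial (Fin 4) K) = C c := by
  unfold PointBlowup.translate; rw [algHom_C, algebraMap_eq]

omit [DecidableEq K] in
/-- **Translations compose additively**: `translate (b + v) = translate v ∘ translate b`. [folklore] -/
theorem translate_add (b v : Fin 4 → K) (P : MvPolynomial (Fin 4) K) :
    PointBlowup.translate (b + v) P = PointBlowup.translate v (PointBlowup.translate b P) := by
  unfold PointBlowup.translate
  rw [← AlgHom.comp_apply]
  congr 1
  refine MvPolynomial.algHom_ext fun i => ?_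
  rw [AlgHom.comp_apply, aeval_X, aeval_X, map_add, aeval_X, algHom_C, algebraMap_eq, Pi.add_apply, map_add]
  ring

omit [DecidableEq K] in
/-- In characteristic `p`, the translate of a `p`-th power polynomial is a `p`-th power polynomial
(`(x + c)^p = x^p + c^p`). [folklore] -/
theorem killed_translate {p : ℕ} [Fact p.Prime] [CharP K p] {R : MvPolynomial (Fin 4) K} (hR : deletePthPowers p R = 0)
    (v : Fin 4 → K) : deletePthPowers p (PointBlowup.translate v R) = 0 := by
  classical
  have hR' := (deletePthPowers_eq_zero_iff p R).mp hR
  have hRsum : R = ∑ d ∈ R.support, monomial d (coeff d R) := (support_sum_monomial_coeff R).symm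
  rw [hRsum]
  unfold PointBlowup.translate
  rw [map_sum]
  refine killed_sum _ fun d hd => ?_
  have hdq : IsPthPowerExponent p d := hR' d (MvPolynomial.mem_support_iff.mp hd)
  rw [aeval_monomial, algebraMap_eq]
  refine killed_mul (isQPow_C p _) ?_
  rw [Finsupp.prod]
  classical
  refine Finset.prod_induction _ (fun x => deletePthPowers p x = 0) (fun a b ha hb => killed_mul ha hb) isQPow_one ?_
  intro i hi
  obtain ⟨m, hm⟩ := (isPthPowerExponent_iff p d).mp hdq i
  rw [hm, pow_mul, add_pow_char, ← map_pow]
  exact killed_pow (killed_add (isQPow_X_pow p i) (isQPow_C p _)) m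

omit [DecidableEq K] in
/-- **Cleaning twice**: `clean (translate v (clean P)) = clean (translate v P)` (characteristic `p`, `q = p`).
[folklore] -/
theorem deletePthPowers_translate_deletePthPowers {p : ℕ} [Fact p.Prime] [CharP K p] (v : Fin 4 → K)
    (P : MvPolynomial (Fin 4) K) :
    deletePthPowers p (PointBlowup.translate v (deletePthPowers p P)) =
      deletePthPowers p (PointBlowup.translate v P) := by
  have hsplit : P = deletePthPowers p P + (P - deletePthPowers p P) := by ring
  conv_rhs => rw [hsplit]
  unfold PointBlowup.translate
  rw [map_add]
  exact (deletePthPowers_add_of_isQPow _ (killed_translate (isQPow_sub_deletePthPowers p P) v)).symm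

omit [DecidableEq K] in
/-- The chart transform of a `q`-th power polynomial is a `q`-th power polynomial. [folklore] -/
theorem killed_chartTransform {q : ℕ} (S : Finset (Fin 4)) (j : Fin 4) {R : MvPolynomial (Fin 4) K}
    (hR : deletePthPowers q R = 0) : deletePthPowers q (chartTransform q S j R) = 0 := by
  classical
  have hR' := (deletePthPowers_eq_zero_iff q R).mp hR
  unfold CentreBlowup.chartTransform
  refine killed_sum _ fun d hd => isQPow_monomial ?_ _
  have hdq := (isPthPowerExponent_iff q d).mp (hR' d (MvPolynomial.mem_support_iff.mp hd))
  rw [isPthPowerExponent_iff]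
  intro i
  rw [chartExponent_apply]
  split_ifs
  · exact Nat.dvd_sub (Finset.dvd_sum fun k _ => hdq k) (dvd_refl q)
  · exact hdq i

omit [DecidableEq K] in
/-- The chart transform of a difference. [folklore] -/
theorem chartTransform_sub (q : ℕ) (S : Finset (Fin 4)) (j : Fin 4) (P Q : MvPolynomial (Fin 4) K) :
    chartTransform q S j (P - Q) = chartTransform q S j P - chartTransform q S j Q := by
  have h := chartTransform_add q S j (P - Q) Q
  rw [sub_add_cancel] at h
  rw [h, add_sub_cancel_right]

omit [DecidableEq K] in
/-- The chart transform commutes with cleaning up to a `q`-th power polynomial: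
`clean (T (chart (clean P))) = clean (T (chart P))` for any translation `T`. [folklore] -/
theorem deletePthPowers_translate_chartTransform_deletePthPowers {p : ℕ} [Fact p.Prime] [CharP K p]
    (S : Finset (Fin 4)) (j : Fin 4) (b : Fin 4 → K) (P : MvPolynomial (Fin 4) K) :
    deletePthPowers p (PointBlowup.translate b (chartTransform p S j (deletePthPowers p P))) =
      deletePthPowers p (PointBlowup.translate b (chartTransform p S j P)) := by
  have hsplit : P = deletePthPowers p P + (P - deletePthPowers p P) := by ring
  conv_rhs => rw [hsplit]
  rw [chartTransform_add]
  unfold PointBlowup.translate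
  rw [map_add]
  exact (deletePthPowers_add_of_isQPow _
    (killed_translate (killed_chartTransform S j (isQPow_sub_deletePthPowers p P)) b)).symm

omit [DecidableEq K] in
/-- A monomial splits as its `S`-part times its off-`S` part. [folklore] -/
theorem monomial_eq_filter_mul (S : Finset (Fin 4)) (d : Fin 4 →₀ ℕ) (c : K) :
    (monomial d c : MvPolynomial (Fin 4) K) =
      monomial (d.filter (· ∈ S)) c * monomial (d.filter (· ∉ S)) 1 := by
  rw [monomial_mul, mul_one, Finsupp.filter_add_filter_not]

omit [DecidableEq K] in
/-- Translating OFF `S` fixes the `S`-part of a monomial. [folklore] -/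
theorem translate_monomial_filter_mem (S : Finset (Fin 4)) {v : Fin 4 → K} (hv : ∀ i ∈ S, v i = 0)
    (d : Fin 4 →₀ ℕ) (c : K) :
    PointBlowup.translate v (monomial (d.filter (· ∈ S)) c) = monomial (d.filter (· ∈ S)) c := by
  classical
  unfold PointBlowup.translate
  rw [aeval_monomial, algebraMap_eq, monomial_eq, Finsupp.prod, Finsupp.prod]
  congr 1
  rw [Finsupp.support_filter]
  refine Finset.prod_congr rfl fun i hi => ?_
  rw [Finset.mem_filter] at hi
  rw [hv i hi.2, map_zero, add_zero]

omit [DecidableEq K] in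
/-- The off-`S` part of a monomial, translated, is a polynomial in the off-`S` variables: all its monomials
`e` have `e i = 0` for `i ∈ S`. [folklore] -/
theorem coeff_translate_monomial_filter_not_mem (S : Finset (Fin 4)) (v : Fin 4 → K) (d : Fin 4 →₀ ℕ)
    {e : Fin 4 →₀ ℕ} (he : coeff e (PointBlowup.translate v (monomial (d.filter (· ∉ S)) (1 : K))) ≠ 0) :
    ∀ i ∈ S, e i = 0 := by
  classical
  intro i hi
  have hvars : e ∈ (PointBlowup.translate v (monomial (d.filter (· ∉ S)) (1 : K))).support :=
    MvPolynomial.mem_support_iff.mpr he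
  by_contra hne
  have hmem : i ∈ (PointBlowup.translate v (monomial (d.filter (· ∉ S)) (1 : K))).vars :=
    (MvPolynomial.mem_vars_iff_mem_support i).mpr ⟨e, hvars, Finsupp.mem_support_iff.mpr hne⟩
  unfold PointBlowup.translate at hmem
  rw [aeval_monomial, algebraMap_eq, map_one, one_mul, Finsupp.prod] at hmem
  have hsub := MvPolynomial.vars_prod (s := (d.filter (· ∉ S)).support)
    (f := fun k => ((X k : MvPolynomial (Fin 4) K) + C (v k)) ^ (d.filter (· ∉ S)) k) hmem
  rw [Finset.mem_biUnion] at hsub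
  obtain ⟨k, hk, hik⟩ := hsub
  rw [Finsupp.support_filter, Finset.mem_filter] at hk
  have hi' := MvPolynomial.vars_pow _ _ hik
  have : i ∈ ((X k : MvPolynomial (Fin 4) K) + C (v k)).vars := hi'
  have hXC : ((X k : MvPolynomial (Fin 4) K) + C (v k)).vars ⊆ {k} := by
    refine (MvPolynomial.vars_add_subset _ _).trans ?_
    rw [MvPolynomial.vars_C, Finset.union_empty]
    rw [MvPolynomial.vars_X]
  have hik' : i = k := Finset.mem_singleton.mp (hXC this)
  exact hk.2 (hik' ▸ hi)

omit [DecidableEq K] in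
/-- The chart transform of `monomial d c * R` for `R` in the off-`S` variables: only the monomial moves
(`chartExponent (d + e) = chartExponent d + e` when `e` vanishes on `S` ∋ `j`). [folklore] -/
theorem chartTransform_monomial_mul_of_vars (q : ℕ) {S : Finset (Fin 4)} {j : Fin 4} (hj : j ∈ S)
    (d : Fin 4 →₀ ℕ) (c : K) {R : MvPolynomial (Fin 4) K} (hR : ∀ e, coeff e R ≠ 0 → ∀ i ∈ S, e i = 0) :
    chartTransform q S j (monomial d c * R) = monomial (chartExponent q S j d) c * R := by
  classical
  conv_lhs => rw [← support_sum_monomial_coeff R, Finset.mul_sum]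
  conv_rhs => rw [← support_sum_monomial_coeff R, Finset.mul_sum]
  rw [chartTransform_sum]
  refine Finset.sum_congr rfl fun e he => ?_
  have he0 := hR e (MvPolynomial.mem_support_iff.mp he)
  rw [monomial_mul, monomial_mul, chartTransform_monomial]
  have hexp : chartExponent q S j (d + e) = chartExponent q S j d + e := by
    ext i
    rw [Finsupp.add_apply, chartExponent_apply, chartExponent_apply]
    split_ifs with h
    · subst h
      rw [he0 i hj, add_zero]
      unfold degIn
      rw [Finset.sum_congr rfl fun k hk => by rw [Finsupp.add_apply, he0 k hk, add_zero]]
    · rw [Finsupp.add_apply]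
  rw [hexp]

omit [DecidableEq K] in
/-- **The chart transform commutes with translations off the centre.** [folklore] -/
theorem chartTransform_translate_of_forall {q : ℕ} {S : Finset (Fin 4)} {j : Fin 4} (hj : j ∈ S)
    {v : Fin 4 → K} (hv : ∀ i ∈ S, v i = 0) (P : MvPolynomial (Fin 4) K) :
    chartTransform q S j (PointBlowup.translate v P) = PointBlowup.translate v (chartTransform q S j P) := by
  classical
  conv_lhs => rw [← support_sum_monomial_coeff P]
  conv_rhs => rw [← support_sum_monomial_coeff P]
  unfold PointBlowup.translate
  rw [map_sum, chartTransform_sum, chartTransform_sum, map_sum]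
  refine Finset.sum_congr rfl fun d _ => ?_
  change chartTransform q S j (PointBlowup.translate v (monomial d (coeff d P))) =
    PointBlowup.translate v (chartTransform q S j (monomial d (coeff d P)))
  rw [monomial_eq_filter_mul S d, chartTransform_monomial_mul_of_vars q hj _ _ (fun e he i hi => ?_)]
  swap
  · classical
    rw [coeff_monomial] at he
    split_ifs at he with h
    · rw [← h, Finsupp.filter_apply, if_neg (not_not.mpr hi)]
    · exact (he rfl).elim
  have hmul : PointBlowup.translate v (monomial (d.filter (· ∈ S)) (coeff d P) * monomial (d.filter (· ∉ S)) 1) =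
      monomial (d.filter (· ∈ S)) (coeff d P) * PointBlowup.translate v (monomial (d.filter (· ∉ S)) (1 : K)) := by
    unfold PointBlowup.translate
    rw [map_mul]
    congr 1
    exact translate_monomial_filter_mem S hv d _
  rw [hmul, chartTransform_monomial_mul_of_vars q hj _ _
    (fun e he => coeff_translate_monomial_filter_not_mem S v d he)]
  have hmul' : PointBlowup.translate v (monomial (chartExponent q S j (d.filter (· ∈ S))) (coeff d P) *
      monomial (d.filter (· ∉ S)) 1) = monomial (chartExponent q S j (d.filter (· ∈ S))) (coeff d P) *
        PointBlowup.translate v (monomial (d.filter (· ∉ S)) (1 : K)) := by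
    unfold PointBlowup.translate
    rw [map_mul]
    congr 1
    have hfix : (chartExponent q S j (d.filter (· ∈ S))).filter (· ∈ S) = chartExponent q S j (d.filter (· ∈ S)) := by
      ext i
      rw [Finsupp.filter_apply]
      split_ifs with h
      · rfl
      · rw [chartExponent_apply, if_neg (fun hij => h (by rw [hij]; exact hj)), Finsupp.filter_apply, if_neg h]
    have := translate_monomial_filter_mem S hv (chartExponent q S j (d.filter (· ∈ S))) (coeff d P)
    rw [hfix] at this
    unfold PointBlowup.translate at this
    exact this
  rw [hmul']

omit [DecidableEq K] in
/-- Permissibility transfers to the translated-and-cleaned polynomial (translation off the centre does not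
lower the order along it; cleaning only deletes monomials). [folklore] -/
theorem isPermissibleCentre_deletePthPowers_translate {q p' : ℕ} {S : Finset (Fin 4)} {v : Fin 4 → K}
    (hv : ∀ i ∈ S, v i = 0) {P : MvPolynomial (Fin 4) K} (hP : IsPermissibleCentre q S P) :
    IsPermissibleCentre q S (deletePthPowers p' (PointBlowup.translate v P)) := by
  classical
  refine ⟨hP.1, le_ordAlong_iff.mpr fun e he => ?_⟩
  have hP2 := le_ordAlong_iff.mp hP.2
  -- `e` is a monomial of `translate v P`
  have he' : coeff e (PointBlowup.translate v P) ≠ 0 := by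
    have := MvPolynomial.mem_support_iff.mp he
    rw [coeff_deletePthPowers] at this
    split_ifs at this with h
    · exact (this rfl).elim
    · exact this
  -- expand `P` in monomials
  have hsum : PointBlowup.translate v P = ∑ d ∈ P.support, monomial (d.filter (· ∈ S)) (coeff d P) *
      PointBlowup.translate v (monomial (d.filter (· ∉ S)) (1 : K)) := by
    conv_lhs => rw [← support_sum_monomial_coeff P]
    unfold PointBlowup.translate
    rw [map_sum]
    refine Finset.sum_congr rfl fun d _ => ?_
    rw [monomial_eq_filter_mul S d, map_mul]
    congr 1
    exact translate_monomial_filter_mem S hv d _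
  rw [hsum, coeff_sum] at he'
  obtain ⟨d, hd, hne⟩ := Finset.exists_ne_zero_of_sum_ne_zero he'
  rw [coeff_monomial_mul'] at hne
  split_ifs at hne with hle
  · have hR : coeff (e - d.filter (· ∈ S)) (PointBlowup.translate v (monomial (d.filter (· ∉ S)) (1 : K))) ≠ 0 :=
      fun h => hne (by rw [h, mul_zero])
    have hzero := coeff_translate_monomial_filter_not_mem S v d hR
    have hdeg : degIn S e = degIn S d := by
      unfold degIn
      refine Finset.sum_congr rfl fun i hi => ?_
      have h1 : (e - d.filter (· ∈ S)) i = 0 := hzero i hi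
      rw [Finsupp.tsub_apply, Finsupp.filter_apply, if_pos hi] at h1
      have h2 : d.filter (· ∈ S) i ≤ e i := hle i
      rw [Finsupp.filter_apply, if_pos hi] at h2
      omega
    rw [hdeg]
    exact hP2 d hd
  · exact (hne rfl).elim

end FlatAbsorb

end Summit.ResolutionOfSingularities.ResolutionOfSingularities.Theorems.PIDim4

end
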